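import Mathlib.Probability.Distributions.Gaussian.Real
import Mathlib.Analysis.SpecialFunctions.Trigonometric.Inverse
import Literature.Probability.Percolation.FKLoopNestingTestFunctions
import Literature.Probability.Percolation.FKLoopNestingEnergyNonneg
import Literature.Probability.LatticeModels.SixVertexGFFHeight
import HarnessLib

/-!
# DKLM 2026, Cor. 10 from Thm. 2.8 and the BKW identity: the printed proof, modulo its inputs

Duminil-Copin–Kozlowski–Lammers–Manolescu, *Gaussian free field convergence of the six-vertex
model with `-1 ≤ Δ ≤ -1/2`*, arXiv:2603.06268 (2026), prove Corollary 10 (the named fact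
`Literature.Probability.Percolation.dklm2026_corollary10` of `FKLoopNestingGaussianLimit`) in one
line, p. 13: "The convergence to the Gaussian free field yields the following corollary", i.e.

* **(BKW, their (3.2), §3.2)** through the Baxter–Kelland–Wu coupling of the critical FK(`q`) loops
  with the six-vertex model at `Δ = -√q/2` (`a = b = 1`, `c = √(2+√q) ∈ [√3, 2]`), in which each
  loop is oriented independently with complex weights `e^{±2πiμ}/√q` (`√q = e^{2πiμ} + e^{-2πiμ}`,
  `μ = arccos(√q/2)/2π`) and the height function jumps by `±1` across it,
  `E^{6V}[e^{i⟨h^{(δ)},φ⟩}] = φ_{δℤ²,q}[∏_{ℓ} cos_μ(φ(int ℓ))]` — "We refer to [their companion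
  paper] for more details";
* **(GFF, their Thm. 8 = Thm. 2.8 (ii))** `⟨h^{(δ)}, φ⟩ → N(0, σ²Σ(φ))` in law, `σ² = 2/arccos Δ`;
* hence `φ_{δℤ²,q}[∏ cos_μ(φ(int ℓ))] = E[cos⟨h^{(δ)},φ⟩] → E[cos N(0,σ²Σ(φ))] = exp(-½σ²Σ(φ))`.

This file formalises exactly that argument with the two inputs as HYPOTHESES (no new named fact):

* `cosMu_eq_bkwAverage`, `prod_cosMu_eq_sum_powerset`, `cexp_dklmMu_add_cexp_neg`: the algebra of
  the BKW step — `cos_μ(x)` is the average of `e^{iεx}` over the orientations `ε = ±1` with weights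
  `e^{2πiμε}/√q`, and `∏_ℓ cos_μ(x_ℓ)` expands as the sum over orientations of the six-vertex
  weight times `e^{i∑_ℓ ε_ℓ x_ℓ}`;
* `dklmSigmaSq_pos`, `dklmSigmaSq_eq_inv_arcsin`, `dklmSigmaSq_eq_dklmSigma_sq`: `σ² > 0` and
  `2/arccos(-√q/2) = 1/arcsin(c/2) = SixVertex.dklmSigma c ^ 2`, `c = √(2+√q)` — Cor. 10's
  constant is Thm. 2.8's constant at the BKW point; `sixVertex_dirichletEnergy_eq`: the two files'
  Dirichlet energies agree on bounded compactly supported densities;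
* `integral_cos_gaussianReal` (`E[cos N(0,v)] = e^{-v/2}`, from Mathlib's `charFun_gaussianReal`),
  `tendsto_of_integral_cos_of_tendsto_gaussian` (the weak-limit step),
  `tendsto_integral_loopNestingWeight_of_gaussianLimit` / `…'` (abstract glue; the primed version
  takes the limit law in the `Real.toNNReal` form of the tree's Thm. 2.8, using `Σ(φ) ≥ 0` from
  `FKLoopNestingEnergyNonneg`), `dklm2026_corollary10_of_gaussianLimit` (the fact from the two
  inputs, test function by test function);
* `tendsto_integral_loopNestingWeight_of_sixVertexGFF`: the instantiation with the tree's named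
  fact `Literature.Probability.LatticeModels.SixVertex.DKLM2026_sixVertex_heightFunction_GFF`
  (Thm. 2.8, `SixVertexGFF`): given a planar six-vertex measure `P₆` at `c = √(2+√q)`, a
  `C_c` zero-mean density `ρ` on the six-vertex side with `Σ_{6V}(ρ) = Σ(φ)` and the BKW identity
  (3.2) for `(ρ, φ)`, Thm. 2.8 (2) gives the conclusion of Cor. 10 for `(q, P, φ)`
  (`measurable_testPairing`: `ω ↦ ⟨h^{(δ)}, ρ⟩` is measurable).

What this makes precise about the status of `dklm2026_corollary10` in the tree: it sits on top of
the (XL, unproved) fact `DKLM2026_sixVertex_heightFunction_GFF`, and beyond it needs (a) the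
infinite-volume BKW identity (3.2), deferred by the authors to their companion paper and absent
from the tree, and (b) Thm. 2.8 (ii) for general finite-energy test functions — the tree's fact
vendors mode (2) for continuous compactly supported densities only, whereas Cor. 10 (and its
consumer `CardyMagicRigidity.MagicFormulaZ2`, bounded densities) quantifies over all finite-energy
generalised test functions. Deliberately NOT here: any statement of (3.2) as a fact (D-0026), the
lattice similarity between the six-vertex lattice and the medial lattice of `δℤ²` (it only enters
through the hypothesis `ρ`), Thm. 11 (anisotropic case).

## References

* H. Duminil-Copin, K. K. Kozlowski, P. Lammers, I. Manolescu, arXiv:2603.06268 (2026): §3.2,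
  (3.2), Thm. 8 (= Thm. 2.8 of the numbered version read in `SixVertexGFF`), Cor. 10 and its proof
  (p. 13).
* R. J. Baxter, S. B. Kelland, F. Y. Wu, J. Phys. A 9 (1976) (the BKW correspondence).
-/

noncomputable section

open MeasureTheory Set Filter Complex ProbabilityTheory
open scoped Real Topology NNReal BoundedContinuousFunction

namespace Literature.Probability.Percolation

open LatticeModels RandomPlanarGeometry

/-! ### The constant `σ²`: positivity and the six-vertex parametrisation -/

/-- `arccos(-√q/2) > 0` (indeed `≥ π/2`). [cite: DuminilCopinKozlowskiLammersManolescu2026, Cor. 10 (σ²)] -/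
theorem arccos_neg_sqrt_div_two_pos (q : ℝ) : 0 < Real.arccos (-(Real.sqrt q / 2)) := by
  apply Real.arccos_pos.2
  have := Real.sqrt_nonneg q
  linarith

/-- DKLM's variance is positive: `σ² = 2/arccos(-√q/2) > 0`.
[cite: DuminilCopinKozlowskiLammersManolescu2026, Cor. 10 (σ²)] -/
theorem dklmSigmaSq_pos (q : ℝ) : 0 < dklmSigmaSq q :=
  div_pos two_pos (arccos_neg_sqrt_div_two_pos q)

/-- `√4 = 2`. [folklore] -/
theorem sqrt_four_eq_two : Real.sqrt 4 = 2 := by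
  rw [show (4 : ℝ) = 2 ^ 2 by norm_num, Real.sqrt_sq (by norm_num)]

/-- `c = √(2+√q) ≤ 2` for `q ≤ 4` (the six-vertex weight of FK(`q`) lies in Thm. 2.8's range).
[cite: DuminilCopinKozlowskiLammersManolescu2026, §3.2 (Δ = -√q/2) with Thm. 8] -/
theorem sqrt_two_add_sqrt_le_two {q : ℝ} (hq : q ≤ 4) : Real.sqrt (2 + Real.sqrt q) ≤ 2 := by
  have h2 : Real.sqrt q ≤ 2 := by
    calc Real.sqrt q ≤ Real.sqrt 4 := Real.sqrt_le_sqrt hq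
      _ = 2 := sqrt_four_eq_two
  calc Real.sqrt (2 + Real.sqrt q) ≤ Real.sqrt 4 := Real.sqrt_le_sqrt (by linarith)
    _ = 2 := sqrt_four_eq_two

/-- `√3 ≤ c = √(2+√q)` for `1 ≤ q`. [cite: DuminilCopinKozlowskiLammersManolescu2026, §3.2 (Δ = -√q/2) with Thm. 8] -/
theorem sqrt_three_le_sqrt_two_add_sqrt {q : ℝ} (hq : 1 ≤ q) :
    Real.sqrt 3 ≤ Real.sqrt (2 + Real.sqrt q) := by
  apply Real.sqrt_le_sqrt
  have : 1 ≤ Real.sqrt q := by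
    rw [← Real.sqrt_one]; exact Real.sqrt_le_sqrt hq
  linarith

/-- `arccos Δ = 2 arcsin(c/2)` at `Δ = -√q/2`, `c = √(2+√q)` (`cos(2 arcsin(c/2)) = 1 - c²/2 = Δ`), for
`q ≤ 4`. [cite: DuminilCopinKozlowskiLammersManolescu2026, Thm. 8 (σ² = 2/arccos Δ = 1/arcsin(c/2))] -/
theorem arccos_neg_sqrt_div_two_eq {q : ℝ} (hq : q ≤ 4) :
    Real.arccos (-(Real.sqrt q / 2)) = 2 * Real.arcsin (Real.sqrt (2 + Real.sqrt q) / 2) := by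
  set c := Real.sqrt (2 + Real.sqrt q) with hc
  have hs0 : 0 ≤ Real.sqrt q := Real.sqrt_nonneg q
  have hc0 : 0 ≤ c := Real.sqrt_nonneg _
  have hc2 : c ≤ 2 := sqrt_two_add_sqrt_le_two hq
  have hcsq : c ^ 2 = 2 + Real.sqrt q := Real.sq_sqrt (by linarith)
  have ha0 : 0 ≤ Real.arcsin (c / 2) := Real.arcsin_nonneg.2 (by positivity)
  have haπ : Real.arcsin (c / 2) ≤ π / 2 := Real.arcsin_le_pi_div_two _
  apply Real.arccos_eq_of_eq_cos (by positivity) (by linarith)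
  rw [Real.cos_two_mul, Real.cos_arcsin, Real.sq_sqrt (by nlinarith)]
  nlinarith

/-- `σ² = 2/arccos(-√q/2) = 1/arcsin(c/2)` with `c = √(2+√q)`, for `q ≤ 4` — the two printed forms of
the variance in Thm. 8 agree at the BKW point of FK(`q`).
[cite: DuminilCopinKozlowskiLammersManolescu2026, Thm. 8 and Cor. 10] -/
theorem dklmSigmaSq_eq_inv_arcsin {q : ℝ} (hq : q ≤ 4) :
    dklmSigmaSq q = 1 / Real.arcsin (Real.sqrt (2 + Real.sqrt q) / 2) := by
  have hpos : 0 < Real.arcsin (Real.sqrt (2 + Real.sqrt q) / 2) := by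
    apply Real.arcsin_pos.2
    have : 0 < Real.sqrt (2 + Real.sqrt q) := Real.sqrt_pos.2 (by positivity)
    positivity
  rw [dklmSigmaSq, arccos_neg_sqrt_div_two_eq hq]
  field_simp

/-! ### The BKW orientation average behind `cos_μ` -/

/-- `e^{iθ} + e^{-iθ} = 2 cos θ` (as complex numbers). [folklore] -/
theorem cexp_mul_I_add_cexp_neg (θ : ℝ) :
    cexp (θ * I) + cexp (-(θ * I)) = ((2 * Real.cos θ : ℝ) : ℂ) := by
  rw [Complex.ofReal_mul, Complex.ofReal_cos, Complex.ofReal_ofNat, Complex.two_cos, neg_mul]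

/-- **The BKW loop weight**: `e^{2πiμ} + e^{-2πiμ} = √q` for `q ≤ 4` — summing the two orientations of
a loop with weights `e^{±2πiμ}` reproduces the loop weight `√q` of the critical FK(`q`) loop
representation. [cite: DuminilCopinKozlowskiLammersManolescu2026, §3.2 (μ = arccos(√q/2)/2π)] -/
theorem cexp_dklmMu_add_cexp_neg {q : ℝ} (hq : q ≤ 4) :
    cexp ((2 * π * dklmMu q : ℝ) * I) + cexp (-((2 * π * dklmMu q : ℝ) * I)) = (Real.sqrt q : ℂ) := by
  rw [cexp_mul_I_add_cexp_neg, cos_two_pi_mul_dklmMu hq]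
  congr 1
  ring

/-- **`cos_μ` is the BKW orientation average**: for `0 < q ≤ 4` and real `x`,
`cos_μ(x) = (e^{2πiμ} e^{ix} + e^{-2πiμ} e^{-ix}) / √q`, i.e. the average of `e^{iεx}` over the two
orientations `ε = ±1` of a loop carrying the complex weights `e^{2πiμε}/√q` (which sum to `1`). With
`x = φ(int ℓ)` and the height function jumping by `ε` across the oriented loop `ℓ`, this is the
loop-by-loop content of the identity `E^{6V}[e^{i⟨h,φ⟩}] = φ_{δℤ²,q}[∏_ℓ cos_μ(φ(int ℓ))]` (DKLM (3.2)).
[cite: DuminilCopinKozlowskiLammersManolescu2026, §3.2, (3.2)] -/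
theorem cosMu_eq_bkwAverage {q : ℝ} (hq0 : 0 < q) (hq : q ≤ 4) (x : ℝ) :
    (cosMu q x : ℂ) =
      (cexp ((2 * π * dklmMu q : ℝ) * I) * cexp (x * I) +
          cexp (-((2 * π * dklmMu q : ℝ) * I)) * cexp (-(x * I))) / (Real.sqrt q : ℂ) := by
  have hnum : cexp ((2 * π * dklmMu q : ℝ) * I) * cexp (x * I) +
      cexp (-((2 * π * dklmMu q : ℝ) * I)) * cexp (-(x * I)) =
      ((2 * Real.cos (x + 2 * π * dklmMu q) : ℝ) : ℂ) := by
    rw [← cexp_mul_I_add_cexp_neg, ← Complex.exp_add, ← Complex.exp_add]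
    congr 1
    · congr 1; push_cast; ring
    · congr 1; push_cast; ring
  have hden : (Real.sqrt q : ℂ) = ((2 * Real.cos (2 * π * dklmMu q) : ℝ) : ℂ) := by
    rw [cos_two_pi_mul_dklmMu hq]; congr 1; ring
  have hcos : Real.cos (2 * π * dklmMu q) ≠ 0 := by
    rw [cos_two_pi_mul_dklmMu hq]; exact (div_pos (Real.sqrt_pos.2 hq0) two_pos).ne'
  rw [hnum, hden, ← Complex.ofReal_div, cosMu]
  congr 1
  field_simp

/-- **BKW expansion of the nesting weight**: for finitely many loops `i ∈ s` with `x_i = φ(int ℓ_i)`,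
`∏_{i∈s} cos_μ(x_i) = ∑_{t ⊆ s} ∏_{i∈t} (e^{2πiμ} e^{ix_i}/√q) ∏_{i∈s∖t} (e^{-2πiμ} e^{-ix_i}/√q)` — the sum
over orientations (`t` = the counterclockwise loops) of the six-vertex weight times `e^{i⟨h,φ⟩}`,
`⟨h, φ⟩ = ∑_i ε_i x_i`. [cite: DuminilCopinKozlowskiLammersManolescu2026, §3.2, (3.2)] -/
theorem prod_cosMu_eq_sum_powerset {q : ℝ} (hq0 : 0 < q) (hq : q ≤ 4) {ι : Type*} [DecidableEq ι]
    (s : Finset ι)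
    (x : ι → ℝ) :
    ((∏ i ∈ s, cosMu q (x i) : ℝ) : ℂ) =
      ∑ t ∈ s.powerset,
        (∏ i ∈ t, cexp ((2 * π * dklmMu q : ℝ) * I) * cexp (x i * I) / (Real.sqrt q : ℂ)) *
          ∏ i ∈ s \ t, cexp (-((2 * π * dklmMu q : ℝ) * I)) * cexp (-(x i * I)) / (Real.sqrt q : ℂ) := by
  rw [Complex.ofReal_prod, ← Finset.prod_add]
  refine Finset.prod_congr rfl fun i _ ↦ ?_
  rw [cosMu_eq_bkwAverage hq0 hq, add_div]

/-! ### The Gaussian side: `E[cos X] = e^{-v/2}` for `X ∼ N(0, v)` and the weak-limit step -/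

/-- Real part of a characteristic-function identity: if `E[e^{iX}] = a ∈ ℝ` then `E[cos X] = a`.
[folklore] -/
theorem integral_cos_eq_of_integral_cexp_eq {Ω : Type*} [MeasurableSpace Ω] {μ : Measure Ω}
    [IsFiniteMeasure μ] {X : Ω → ℝ} (hX : AEMeasurable X μ) {a : ℝ}
    (h : ∫ ω, cexp (X ω * I) ∂μ = a) : ∫ ω, Real.cos (X ω) ∂μ = a := by
  have hint : Integrable (fun ω ↦ cexp (X ω * I)) μ := by
    refine (integrable_const (1 : ℝ)).mono' ?_ (ae_of_all _ fun ω ↦ ?_)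
    · exact (Complex.measurable_exp.comp_aemeasurable
        ((Complex.measurable_ofReal.comp_aemeasurable hX).mul_const I)).aestronglyMeasurable
    · rw [norm_exp_ofReal_mul_I]
  have h2 : ∫ ω, RCLike.re (cexp (X ω * I)) ∂μ = RCLike.re (∫ ω, cexp (X ω * I) ∂μ) :=
    integral_re hint
  simp only [RCLike.re_to_complex, exp_ofReal_mul_I_re] at h2
  rw [h2, h, Complex.ofReal_re]

/-- `E[cos X] = e^{-v/2}` for `X ∼ N(0, v)` (real part of Mathlib's `charFun_gaussianReal` at `t = 1`).
[folklore] -/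
theorem integral_cos_gaussianReal (v : ℝ≥0) :
    ∫ x, Real.cos x ∂(gaussianReal 0 v) = Real.exp (-(v : ℝ) / 2) := by
  have h := charFun_gaussianReal (μ := 0) (v := v) 1
  rw [charFun_apply_real] at h
  simp only [Complex.ofReal_one, one_mul, Complex.ofReal_zero, mul_zero, zero_mul, one_pow,
    mul_one, zero_sub] at h
  refine integral_cos_eq_of_integral_cexp_eq (X := fun x : ℝ ↦ x) aemeasurable_id ?_
  rw [h, Complex.ofReal_exp]
  congr 1
  push_cast
  ring

/-- **The weak-limit step of Cor. 10**: if `E[cos X_i] = a_i` eventually and the laws of `X_i` converge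
weakly (tested on bounded continuous functions) to `N(0, v)`, then `a_i → e^{-v/2}`.
[cite: DuminilCopinKozlowskiLammersManolescu2026, Cor. 10 (proof: "the convergence to the GFF yields")] -/
theorem tendsto_of_integral_cos_of_tendsto_gaussian {ι Ω : Type*} {l : Filter ι} [MeasurableSpace Ω]
    {P : Measure Ω} (X : ι → Ω → ℝ) {a : ι → ℝ} {v : ℝ≥0}
    (hcos : ∀ᶠ i in l, ∫ ω, Real.cos (X i ω) ∂P = a i)
    (hlim : ∀ g : ℝ →ᵇ ℝ,
      Tendsto (fun i ↦ ∫ ω, g (X i ω) ∂P) l (𝓝 (∫ x, g x ∂(gaussianReal 0 v)))) :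
    Tendsto a l (𝓝 (Real.exp (-(v : ℝ) / 2))) := by
  let g : ℝ →ᵇ ℝ := BoundedContinuousFunction.mkOfBound ⟨Real.cos, Real.continuous_cos⟩ 2
    (fun x y ↦ by
      rw [ContinuousMap.coe_mk, Real.dist_eq]
      have h1 := Real.abs_cos_le_one x
      have h2 := Real.abs_cos_le_one y
      calc |Real.cos x - Real.cos y| ≤ |Real.cos x| + |Real.cos y| := abs_sub _ _
        _ ≤ 2 := by linarith)
  have hg : ∀ x, g x = Real.cos x := fun _ ↦ rfl
  have h := hlim g
  simp only [hg, integral_cos_gaussianReal] at h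
  exact h.congr' hcos

/-! ### Corollary 10 from a Gaussian limit of the height-function pairing and the BKW identity -/

/-- **Abstract glue (variance as an `ℝ≥0`)**: if real observables `X_δ` on a finite measure space
`(Ω, P₆)` satisfy the BKW-type identity `E_{P₆}[e^{iX_δ}] = E_P[∏_ℓ cos_μ(φ(int ℓ))]` for all small
`δ > 0` and converge in law to `N(0, v)` as `δ → 0⁺`, then `E_P[∏_ℓ cos_μ(φ(int ℓ))] → e^{-v/2}`.
[cite: DuminilCopinKozlowskiLammersManolescu2026, Cor. 10 (proof) with (3.2)] -/
theorem tendsto_integral_loopNestingWeight_of_gaussianLimit {q : ℝ} {P : Measure (BondConfig (Site 2))}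
    {φ : SignedMeasure ℂ} {Ω : Type*} [MeasurableSpace Ω] {P₆ : Measure Ω} [IsFiniteMeasure P₆]
    (X : ℝ → Ω → ℝ) (hX : ∀ δ, AEMeasurable (X δ) P₆) {v : ℝ≥0}
    (hBKW : ∀ᶠ δ in 𝓝[>] 0,
      ∫ ω, cexp (X δ ω * I) ∂P₆ = ((∫ ω, loopNestingWeight q φ δ ω ∂P : ℝ) : ℂ))
    (hGFF : ∀ g : ℝ →ᵇ ℝ,
      Tendsto (fun δ ↦ ∫ ω, g (X δ ω) ∂P₆) (𝓝[>] 0) (𝓝 (∫ x, g x ∂(gaussianReal 0 v)))) :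
    Tendsto (fun δ : ℝ ↦ ∫ ω, loopNestingWeight q φ δ ω ∂P) (𝓝[>] 0)
      (𝓝 (Real.exp (-(v : ℝ) / 2))) :=
  tendsto_of_integral_cos_of_tendsto_gaussian X
    (hBKW.mono fun δ hδ ↦ integral_cos_eq_of_integral_cexp_eq (hX δ) hδ) hGFF

/-! ### Corollary 10 from a Gaussian limit — the `X`-shaped (DKLM Thm. 2.8 (2)) form -/

/-- **Glue, in the shape of the tree's Thm. 2.8**: same as
`tendsto_integral_loopNestingWeight_of_gaussianLimit`, the limiting law being written as in
`SixVertex.DKLM2026_sixVertex_heightFunction_GFF`, mode (2): `N(0, (σ²Σ(φ))⁺)` with Mathlib's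
`Real.toNNReal`; the truncation is harmless because `σ² > 0` (`dklmSigmaSq_pos`) and `Σ(φ) ≥ 0`
(`dirichletEnergy_nonneg`). [cite: DuminilCopinKozlowskiLammersManolescu2026, Cor. 10 (proof) with Thm. 8 = Thm. 2.8 (ii)] -/
theorem tendsto_integral_loopNestingWeight_of_gaussianLimit' {q : ℝ}
    {P : Measure (BondConfig (Site 2))} {φ : SignedMeasure ℂ} (hφ : IsGeneralisedTestFunction φ)
    (hE : HasFiniteDirichletEnergy φ) {Ω : Type*} [MeasurableSpace Ω] {P₆ : Measure Ω}
    [IsFiniteMeasure P₆] (X : ℝ → Ω → ℝ) (hX : ∀ δ, AEMeasurable (X δ) P₆)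
    (hBKW : ∀ᶠ δ in 𝓝[>] 0,
      ∫ ω, cexp (X δ ω * I) ∂P₆ = ((∫ ω, loopNestingWeight q φ δ ω ∂P : ℝ) : ℂ))
    (hGFF : ∀ g : ℝ →ᵇ ℝ,
      Tendsto (fun δ ↦ ∫ ω, g (X δ ω) ∂P₆) (𝓝[>] 0)
        (𝓝 (∫ x, g x ∂(gaussianReal 0 (Real.toNNReal (dklmSigmaSq q * dirichletEnergy φ)))))) :
    Tendsto (fun δ : ℝ ↦ ∫ ω, loopNestingWeight q φ δ ω ∂P) (𝓝[>] 0)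
      (𝓝 (Real.exp (-(dklmSigmaSq q / 2) * dirichletEnergy φ))) := by
  have h := tendsto_integral_loopNestingWeight_of_gaussianLimit X hX hBKW hGFF
  have hnn : 0 ≤ dklmSigmaSq q * dirichletEnergy φ :=
    mul_nonneg (dklmSigmaSq_pos q).le (dirichletEnergy_nonneg hφ hE)
  rw [Real.coe_toNNReal _ hnn] at h
  convert h using 3
  ring

/-- **DKLM's proof of Cor. 10, formalised modulo its two inputs.** "The convergence to the Gaussian
free field yields the following corollary": if, for every `q ∈ [1,4]`, every critical
random-cluster limit `P` and every finite-energy test function `φ`, there is a probability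
measure `P₆` on six-vertex arrow configurations and real observables `X_δ` (the pairings
`⟨h^{(δ)}, φ⟩` of the six-vertex height function) such that
**(BKW, DKLM (3.2))** `E_{P₆}[e^{i X_δ}] = E_P[∏_ℓ cos_μ(φ(int ℓ))]` for all small `δ > 0`, and
**(GFF, DKLM Thm. 2.8 (2))** `X_δ → N(0, σ²Σ(φ))` in law as `δ → 0⁺`,
then Corollary 10 holds. Both inputs are hypotheses here: the tree's named fact
`SixVertex.DKLM2026_sixVertex_heightFunction_GFF` is Thm. 2.8 (2) for continuous compactly
supported densities only, and the infinite-volume BKW identity (3.2) is deferred by the authors to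
their companion paper. [cite: DuminilCopinKozlowskiLammersManolescu2026, Cor. 10 (proof, p. 13) and (3.2)] -/
theorem dklm2026_corollary10_of_gaussianLimit
    (H : ∀ q ∈ Set.Icc (1 : ℝ) 4, ∀ P : Measure (BondConfig (Site 2)),
      IsFreeRandomClusterLimit (rcSelfDualPoint q) q P →
      ∀ φ : SignedMeasure ℂ, IsGeneralisedTestFunction φ → HasFiniteDirichletEnergy φ →
      ∃ (P₆ : Measure (SixVertex.Config (ℤ × ℤ))) (_ : IsProbabilityMeasure P₆)
        (X : ℝ → SixVertex.Config (ℤ × ℤ) → ℝ),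
        (∀ δ, AEMeasurable (X δ) P₆) ∧
        (∀ᶠ δ in 𝓝[>] 0,
          ∫ ω, cexp (X δ ω * I) ∂P₆ = ((∫ ω, loopNestingWeight q φ δ ω ∂P : ℝ) : ℂ)) ∧
        (∀ g : ℝ →ᵇ ℝ,
          Tendsto (fun δ ↦ ∫ ω, g (X δ ω) ∂P₆) (𝓝[>] 0)
            (𝓝 (∫ x, g x ∂(gaussianReal 0 (Real.toNNReal (dklmSigmaSq q * dirichletEnergy φ))))))) :
    dklm2026_corollary10 := by
  intro q hq P hP φ hφ hE
  obtain ⟨P₆, hP₆, X, hX, hBKW, hGFF⟩ := H q hq P hP φ hφ hE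
  exact tendsto_integral_loopNestingWeight_of_gaussianLimit' hφ hE X hX hBKW hGFF

/-! ### Instantiating with the tree's Thm. 2.8 (`SixVertexGFF`) -/

/-- `σ²(q) = σ(c)²` with `c = √(2 + √q)` — the six-vertex weight of the BKW point of FK(`q`)
(`Δ = (2 - c²)/2 = -√q/2`; `q = 1 ↔ c = √3`, `q = 4 ↔ c = 2`), `σ(c)² = 1 / arcsin(c/2)` being the
constant of `SixVertex.DKLM2026_sixVertex_heightFunction_GFF`.
[cite: DuminilCopinKozlowskiLammersManolescu2026, Thm. 8 (= Thm. 2.8) and Cor. 10] -/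
theorem dklmSigmaSq_eq_dklmSigma_sq {q : ℝ} (hq : q ≤ 4) :
    dklmSigmaSq q = SixVertex.dklmSigma (Real.sqrt (2 + Real.sqrt q)) ^ 2 := by
  rw [SixVertex.dklmSigma_sq (Real.arcsin_nonneg.2 (by positivity)), dklmSigmaSq_eq_inv_arcsin hq]

/-- **The two Dirichlet energies agree on densities**: for `f` measurable, bounded and vanishing
outside a ball, the six-vertex file's `SixVertex.dirichletEnergy f = ∬ G f ⊗ f` (Lebesgue double
integral) equals `dirichletEnergy (f · Leb)` of `FKLoopNestingGaussianLimit` (iterated Jordan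
integral): in `tendsto_integral_loopNestingWeight_of_sixVertexGFF` with `φ = f · Leb` and `ρ = f`
the energy hypothesis holds by this lemma. [cite: DuminilCopinKozlowskiLammersManolescu2026, Def. 6(ii)] -/
theorem sixVertex_dirichletEnergy_eq {f : ℂ → ℝ} {C R : ℝ} (hf : Measurable f)
    (hC : ∀ z, |f z| ≤ C) (hR : ∀ z, R < ‖z‖ → f z = 0) :
    SixVertex.dirichletEnergy f = dirichletEnergy ((volume : Measure ℂ).withDensityᵥ f) := by
  rw [dirichletEnergy_withDensityᵥ hf hC hR, SixVertex.dirichletEnergy, ← integral_const_mul]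
  refine integral_congr_ae (ae_of_all _ fun z ↦ ?_)
  dsimp only
  rw [← integral_const_mul]
  refine integral_congr_ae (ae_of_all _ fun w ↦ ?_)
  dsimp only
  rw [SixVertex.greenPlane, norm_sub_rev w z]
  ring

/-- The six-vertex test pairing `ω ↦ ⟨h^{(δ)}, ρ⟩ = ∫ h(z/δ) ρ(z) dz` is measurable for
measurable `ρ` (the height function is jointly measurable in `(ω, z)`, being a measurable
function of `ω` and of the lattice face containing `z/δ`). [cite: DKLM2026SixVertexGFF, Def. 2.5] -/
theorem measurable_testPairing (δ : ℝ) {ρ : ℂ → ℝ} (hρ : Measurable ρ) :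
    Measurable fun ω : SixVertex.Config (ℤ × ℤ) ↦ SixVertex.testPairing ω δ ρ := by
  have hg : Measurable fun q : SixVertex.Config (ℤ × ℤ) × (ℤ × ℤ) ↦ (SixVertex.heightAt q.1 q.2 : ℝ) := by
    refine measurable_from_prod_countable_left fun m ↦ ?_
    exact (measurable_of_countable (Int.cast : ℤ → ℝ)).comp (SixVertex.measurable_heightAt m)
  have hh : Measurable fun p : SixVertex.Config (ℤ × ℤ) × ℂ ↦
      (p.1, (⌊(p.2 / (δ : ℂ)).re⌋, ⌊(p.2 / (δ : ℂ)).im⌋)) :=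
    measurable_fst.prodMk
      ((Int.measurable_floor.comp (Complex.measurable_re.comp (measurable_snd.div_const _))).prodMk
        (Int.measurable_floor.comp (Complex.measurable_im.comp (measurable_snd.div_const _))))
  have hF : Measurable (Function.uncurry fun (ω : SixVertex.Config (ℤ × ℤ)) (z : ℂ) ↦
      (SixVertex.heightScaled ω δ z : ℝ) * ρ z) := by
    change Measurable fun p : SixVertex.Config (ℤ × ℤ) × ℂ ↦
      (SixVertex.heightScaled p.1 δ p.2 : ℝ) * ρ p.2
    exact (hg.comp hh).mul (hρ.comp measurable_snd)
  exact (hF.stronglyMeasurable.integral_prod_right (ν := volume)).measurable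

/-- **Cor. 10 for one test function from the tree's Thm. 2.8 and the BKW identity.** Let
`q ∈ [1,4]`, `c = √(2+√q)` (so `√3 ≤ c ≤ 2`), `P₆` a planar slope-zero six-vertex measure for the
weights `(1,1,c)` and `ρ` a continuous compactly supported zero-mean density — the six-vertex-side
test function corresponding to `φ` (for DKLM: `φ` read on the medial lattice through the lattice
similarity of the module docstring of `FKLoopNestingGaussianLimit`), with the same Dirichlet
energy. IF the BKW identity (3.2) `E_{P₆}[e^{i⟨h^{(δ)},ρ⟩}] = E_P[∏_ℓ cos_μ(φ(int ℓ))]` holds for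
small `δ`, THEN the named fact `SixVertex.DKLM2026_sixVertex_heightFunction_GFF` (Thm. 2.8, mode
(2)) yields the conclusion of Corollary 10 for `(q, P, φ)`. This is exactly the printed one-line
proof; what it leaves open is (3.2) in infinite volume and test functions beyond `C_c` densities.
[cite: DuminilCopinKozlowskiLammersManolescu2026, Cor. 10 (proof) and (3.2)] -/
theorem tendsto_integral_loopNestingWeight_of_sixVertexGFF
    (hX : SixVertex.DKLM2026_sixVertex_heightFunction_GFF) {q : ℝ} (hq : q ∈ Set.Icc (1 : ℝ) 4)
    (P : Measure (BondConfig (Site 2))) {φ : SignedMeasure ℂ} (hφ : IsGeneralisedTestFunction φ)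
    (hE : HasFiniteDirichletEnergy φ) {P₆ : Measure (SixVertex.Config (ℤ × ℤ))}
    (hP₆ : SixVertex.IsPlanarSixVertexMeasure 1 1 (Real.sqrt (2 + Real.sqrt q)) P₆)
    {ρ : ℂ → ℝ} (hρc : Continuous ρ) (hρs : HasCompactSupport ρ) (hρ0 : ∫ z, ρ z = 0)
    (hρE : SixVertex.dirichletEnergy ρ = dirichletEnergy φ)
    (h32 : ∀ᶠ δ in 𝓝[>] 0,
      ∫ ω, cexp (SixVertex.testPairing ω δ ρ * I) ∂P₆ =
        ((∫ ω, loopNestingWeight q φ δ ω ∂P : ℝ) : ℂ)) :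
    Tendsto (fun δ : ℝ ↦ ∫ ω, loopNestingWeight q φ δ ω ∂P) (𝓝[>] 0)
      (𝓝 (Real.exp (-(dklmSigmaSq q / 2) * dirichletEnergy φ))) := by
  set c := Real.sqrt (2 + Real.sqrt q) with hc
  haveI : IsProbabilityMeasure P₆ := hP₆.1
  obtain ⟨-, h2⟩ := hX c (sqrt_three_le_sqrt_two_add_sqrt hq.1) (sqrt_two_add_sqrt_le_two hq.2) P₆ hP₆
  have hg := h2 ρ hρc hρs hρ0
  have hvar : SixVertex.dklmSigma c ^ 2 * SixVertex.dirichletEnergy ρ =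
      dklmSigmaSq q * dirichletEnergy φ := by
    rw [hρE, ← dklmSigmaSq_eq_dklmSigma_sq hq.2]
  rw [hvar] at hg
  exact tendsto_integral_loopNestingWeight_of_gaussianLimit' hφ hE
    (fun δ ω ↦ SixVertex.testPairing ω δ ρ)
    (fun δ ↦ (measurable_testPairing δ hρc.measurable).aemeasurable) h32 hg

end Literature.Probability.Percolation

end
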